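import Summits.Parity.GeneralizedHardyLittlewood.Theses.DeterminantMoebiusCores

/-!
# Line `theta-lift` for the crux `PairCores` — route `DeterminantMoebiusCores`, item stmt-Parity-15171

Strategist line (planner-cstrat-stmt-Parity-15171-s1-0, 2026-08-17), registered as an ALTERNATIVE to the
registrar's line `birth` (Lines/birth.lean: hyperbolic trichotomy by `D = d₁d₂` at the crux's own truncation
`N^θ`). Same heart (signed two-point Möbius cancellation along the e-lines of the determinant variety);
different cut, chosen so that at level `ν = 0` every stub except the heart is theorem-grade IN PRINT and the
open band of `birth`'s centre (`N^{1/3} < min dᵢ < N^{5/11}` at `D ≈ N`) disappears.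

**The move (θ-lift = un-opening of every small Möbius divisor).** Write `Λ♯_θ(m) = ∑_{d ∣ m, d > N^θ} μ(d) log(m/d)`
and, for `θ ≤ θ' := 1/2 − ν − κ`, the BAND `B(m) = Λ♯_θ(m) − Λ♯_{θ'}(m) = ∑_{d ∣ m, N^θ < d ≤ N^{θ'}} μ(d) log(m/d)`
(a SHORT divisor sum: every divisor is `≤ N^{1/2−ν−κ}`). Then, identically,
`Λ♯_θ(m₁)Λ♯_θ(m₂) = [B(m₁)B(m₂) + B(m₁)Λ♯_{θ'}(m₂) + Λ♯_{θ'}(m₁)B(m₂)] + Λ♯_{θ'}(m₁)Λ♯_{θ'}(m₂)`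
(`lamSharp_mul_lift`). In the crux's frame (level `q ≤ N^ν`, tame classes, divisor weight, worst intervals):
* the three band terms are ONE-POINT objects — a short divisor `d ≤ N^{θ'}` of one form times either another
  short divisor (lattice counting modulo `q d d' ≤ N^{1−ν−2κ}`, n-lines of length `≥ N^{2κ}`) or the full
  `Λ♯_{θ'} = Λ − Λ♭_{θ'}` of the other form in a progression of modulus `q·d ≤ N^{1/2−κ}`: primes in progressions
  below level `1/2` (Bombieri–Vinogradov, PROVED in the tree: `Literature.NumberTheory.Sieve.BombieriVinogradovStatement_holds`)
  plus lattice counts for `Λ♭_{θ'}` plus the tame-class main-term matching of `OpeningReduction` (iii) — PROVABLE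
  (`stub_bandTerms`);
* what is left is the crux AT THE MAXIMAL TRUNCATION `θ' = 1/2 − ν − κ`: both Möbius variables are now LARGE,
  `dᵢ > N^{1/2−ν−κ}`, i.e. both cofactors `eᵢ = ψᵢ(n)/dᵢ ≤ 2L·N^{1/2+ν+κ}`. On this lifted core run `birth`'s
  hyperbolic trichotomy in `D = d₁d₂` (`lamSharp_mul_split`): smooth side `D ≤ N^{1−η}` (lattice counting, as
  `birth`; `stub_liftedSmooth`), centre `N^{1−η} < D ≤ N^{1+η}` (`stub_liftedCentre`), Möbius side `D > N^{1+η}`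
  (`stub_liftedMoebius`, the heart).
* AT `ν = 0` the lifted centre is the box `dᵢ ∈ (N^{1/2−κ}, 2L N^{1/2+κ+η}]`, `D ≤ N^{1+η}`: for `κ < 1/22`,
  `η < 1/95` this is INSIDE the range of Duke–Friedlander–Iwaniec's determinant theorem (lower row `(a₁d₂, a₂d₁)`
  with the general weights `μ`, upper row `(e₁, e₂)` with the smooth weights `log eᵢ ×` dyadic bumps, Mellin
  separation of the interval cut-off; error `‖a‖‖b‖(N₁N₂)^{3/8}(N₁+N₂)^{11/48}N^{o(1)} = N^{95/96+O(κ+η)} < N`;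
  zero-frequency term = Möbius tails `≪ (log N)^{−A}`), a NAMED FACT OF THE TREE WITH ITS DISCHARGE:
  `Literature.NumberTheory.LFunctions.DukeFriedlanderIwaniec1997_determinant(_holds)`. So at level 0 the line
  reads: PairCores(ν = 0) = [BV] + [lattice/TSS] + [DFI Thm 1] + HEART. In `birth` the centre at `ν = 0` keeps
  the open band `N^{1/3} < min dᵢ < N^{5/11}` because inside a `D`-window one cannot sum over all small `d₁`
  (the un-opening needs a product region `{d₂ ≤ Y} × {all d₁}`): the ORDER "lift first, window second" is the
  point of this line.
* At `ν > 0` the lifted centre needs DFI with an extra congruence `d₁e₁ ≡ c (mod a₁q)` on tame classes, worst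
  residue per `q`, `ℓ¹` over `q ≤ N^ν`: polynomial dependence on `q` in the Kloosterman-fraction bound gives some
  `ν₀ > 0` (in kind); for the levels the consumer `OpeningReduction` uses at `t ≥ 3` (`ν = (t−2)/(2t) ≥ 1/6`) it
  is OPEN, exactly as `birth`'s centre — hence `∃ κ₀`/`∃ η` are the prover's to choose and the stub is graded
  "theorem-grade at ν = 0, open at ν ≥ ν₀".

`PairCores_of` (REAL proof, no `sorry`; conclusion literally the route decl
`Summit.Parity.GeneralizedHardyLittlewood.Theses.DeterminantMoebiusCores.PairCores`): from `stub_liftedCentre` at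
saving `A+1` take `κ₀`; put `κ := min κ₀ (1/2 − ν − θ) > 0` (so `θ ≤ θ' = 1/2 − ν − κ` and `κ ≤ κ₀`), take `η > ν`
and `N_B`; then `N_A, N_S, N_M` from the other three stubs at `(A+1, κ, η)`; `N₀ = max(…, 64)`; the identity
`Λ♯_θΛ♯_θ = bands + core_{θ'}(≤ N^{1−η}) + core_{θ'}((N^{1−η}, N^{1+η}]) + core_{θ'}(> N^{1+η})`, the triangle
inequality inside the tame indicator (`weighted_sum_le_of_split4`) and `4N/(log N)^{A+1} ≤ N/(log N)^A` for
`N ≥ 64` (`log 64 = 6 log 2 > 4`).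

**Hardest stub:** `stub_liftedMoebius` — the heart, unchanged in kind from `birth`'s `stub_moebiusSide` (and
implied by it at `θ := 1/2 − ν − κ`, whose tameness threshold `N^{θ'/2}` is weaker): e-lines
`n ↦ (ψ₁(n)/e₁, ψ₂(n)/e₂)`, `e₁e₂ ≤ 4L²N^{1−η}`, now with `eᵢ ≤ 2L N^{1/2+ν+κ}` as well, carrying `μ(d₁(n))μ(d₂(n))`;
the terms `dᵢ = ψᵢ(n)` vanish (`log 1 = 0`) and each fixed small cofactor pair is a Cesàro dilated pair-Chowla sum with
the constant weight `log e₁ log e₂` (for `Ψ = (n, n+2)`, `(e₁,e₂) = (2,2)` gives `log²2 · Σ_{m ≤ N/2} μ(m)μ(m+1)`); HL-pair complete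
at `ν = 0` (route items CoresToTwin/TwinReduction: `TwinCores(h) ⟺ PairsHL(h)`), Siegel-sensitive (MatomakiMerikoski2023
Thm 1.3), only log-averaged `(log N)^{−c}` savings known for pair-Chowla (Pilatte 2023, arXiv:2310.19357).

**Disproof used:** none exists for stmt-Parity-15171 (`ledger crux ls`: only Lines/birth.lean; no `Disproof.lean`,
no `_false_without_` theorem, no `Theorems/PairCores/Negative/*`), 2026-08-17. Negatives index (9541, 14832, 4218):
no stub is an instance (no convolution moment, no multiplicative Elliott slot, no `ℓ²` rectangle). The strategist's
census (Cruxes/PairCores/STRATEGY-CENSUS.md) records the Siegel chain `MM → USZ → HigherCores → OpeningReduction →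
¬PairCores` (kernel-checked in StrategistSketch.lean): every stub here is a CONSEQUENCE-in-kind of the crux on tame
classes and none asserts anything in the illusory world beyond what the crux does.
-/

set_option linter.unusedVariables false

namespace Summit.Parity.GeneralizedHardyLittlewood.Cruxes.PairCores.ThetaLift

open scoped BigOperators Topology Manifold Classical MeasureTheory ProbabilityTheory Matrix InnerProductSpace ComplexConjugate ContinuousMap
open Filter Set Function TopologicalSpace MeasureTheory
open Summit.Parity.GeneralizedHardyLittlewood.Theses.DeterminantMoebiusCores

/-! ### The opened core, the band, the lift (definitions unfold to the crux's own terms) -/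

/-- The summand of the crux's inlined `Λ♯_{N^θ}`: `[N^θ < d] · μ(d) · log(m/d)`. -/
noncomputable def sharpTerm (N : ℕ) (θ : ℝ) (m d : ℕ) : ℝ :=
  if (N : ℝ) ^ θ < (d : ℝ) then (ArithmeticFunction.moebius d : ℝ) * Real.log ((m : ℝ) / (d : ℝ)) else 0

/-- `Λ♯_{N^θ}(m) = ∑_{d ∣ m, d > N^θ} μ(d) log(m/d)` — by unfolding, literally the crux's factor at
`m = (ψᵢ(n)).toNat`. -/
noncomputable def lamSharp (N : ℕ) (θ : ℝ) (m : ℕ) : ℝ :=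
  ∑ d ∈ Nat.divisors m, sharpTerm N θ m d

/-- The BAND between two truncations: `B_{θ,θ'}(m) = Λ♯_θ(m) − Λ♯_{θ'}(m)`; for `θ ≤ θ'` (and `N ≥ 1`) it is the
short divisor sum `∑_{d ∣ m, N^θ < d ≤ N^{θ'}} μ(d) log(m/d)` (`bandTerm_eq_sum`). -/
noncomputable def bandTerm (N : ℕ) (θ θ' : ℝ) (m : ℕ) : ℝ :=
  lamSharp N θ m - lamSharp N θ' m

/-- The three BAND TERMS of the lift `Λ♯_θΛ♯_θ = bands + Λ♯_{θ'}Λ♯_{θ'}`: band × band, band × lifted,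
lifted × band. Each carries at least one SHORT divisor (`≤ N^{θ'}`). -/
noncomputable def bandTerms (N : ℕ) (θ θ' : ℝ) (m₁ m₂ : ℕ) : ℝ :=
  bandTerm N θ θ' m₁ * bandTerm N θ θ' m₂ + bandTerm N θ θ' m₁ * lamSharp N θ' m₂ +
    lamSharp N θ' m₁ * bandTerm N θ θ' m₂

/-- The opened two-point core at truncation `θ`, restricted to Möbius pairs whose product `d₁d₂` (read in `ℝ`)
lies in the window `S` (as in `birth`). -/
noncomputable def coreOn (N : ℕ) (θ : ℝ) (S : Set ℝ) (m₁ m₂ : ℕ) : ℝ :=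
  ∑ d₁ ∈ Nat.divisors m₁, ∑ d₂ ∈ Nat.divisors m₂,
    if ((d₁ * d₂ : ℕ) : ℝ) ∈ S then sharpTerm N θ m₁ d₁ * sharpTerm N θ m₂ d₂ else 0

/-- THE LIFT (an identity of real numbers): `Λ♯_θ(m₁)Λ♯_θ(m₂) = bandTerms + Λ♯_{θ'}(m₁)Λ♯_{θ'}(m₂)`.
[bookkeeping] -/
theorem lamSharp_mul_lift (N : ℕ) (θ θ' : ℝ) (m₁ m₂ : ℕ) :
    lamSharp N θ m₁ * lamSharp N θ m₂ =
      bandTerms N θ θ' m₁ m₂ + lamSharp N θ' m₁ * lamSharp N θ' m₂ := by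
  unfold bandTerms bandTerm
  ring

/-- The band is the short divisor sum over `N^θ < d ≤ N^{θ'}` (transparency lemma; not used by the
composition). [bookkeeping] -/
theorem bandTerm_eq_sum (N : ℕ) {θ θ' : ℝ} (hθ : θ ≤ θ') (hN : 1 ≤ N) (m : ℕ) :
    bandTerm N θ θ' m = ∑ d ∈ Nat.divisors m,
      if (N : ℝ) ^ θ < (d : ℝ) ∧ (d : ℝ) ≤ (N : ℝ) ^ θ' then
        (ArithmeticFunction.moebius d : ℝ) * Real.log ((m : ℝ) / (d : ℝ)) else 0 := by
  unfold bandTerm lamSharp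
  rw [← Finset.sum_sub_distrib]
  refine Finset.sum_congr rfl fun d _ => ?_
  have hmono : (N : ℝ) ^ θ ≤ (N : ℝ) ^ θ' :=
    Real.rpow_le_rpow_of_exponent_le (by exact_mod_cast hN) hθ
  unfold sharpTerm
  by_cases h' : (N : ℝ) ^ θ' < (d : ℝ)
  · have h : (N : ℝ) ^ θ < (d : ℝ) := lt_of_le_of_lt hmono h'
    have hn : ¬ ((N : ℝ) ^ θ < (d : ℝ) ∧ (d : ℝ) ≤ (N : ℝ) ^ θ') := fun hh => absurd hh.2 (not_le.mpr h')
    rw [if_pos h, if_pos h', if_neg hn]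
    ring
  · have hle : (d : ℝ) ≤ (N : ℝ) ^ θ' := not_lt.mp h'
    by_cases h : (N : ℝ) ^ θ < (d : ℝ)
    · rw [if_pos h, if_neg h', if_pos ⟨h, hle⟩]
      ring
    · have hn : ¬ ((N : ℝ) ^ θ < (d : ℝ) ∧ (d : ℝ) ≤ (N : ℝ) ^ θ') := fun hh => absurd hh.1 h
      rw [if_neg h, if_neg h', if_neg hn]
      ring

/-- HYPERBOLIC TRICHOTOMY of the (lifted) core (an identity of finite sums, as in `birth`): smooth side
`d₁d₂ ≤ X₁`, centre `X₁ < d₁d₂ ≤ X₂`, Möbius side `d₁d₂ > X₂`. [bookkeeping] -/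
theorem lamSharp_mul_split (N : ℕ) (θ : ℝ) {X₁ X₂ : ℝ} (hX : X₁ ≤ X₂) (m₁ m₂ : ℕ) :
    lamSharp N θ m₁ * lamSharp N θ m₂ =
      coreOn N θ (Set.Iic X₁) m₁ m₂ + coreOn N θ (Set.Ioc X₁ X₂) m₁ m₂ +
        coreOn N θ (Set.Ioi X₂) m₁ m₂ := by
  unfold lamSharp coreOn
  rw [Finset.sum_mul_sum, ← Finset.sum_add_distrib, ← Finset.sum_add_distrib]
  refine Finset.sum_congr rfl fun d₁ _ => ?_
  rw [← Finset.sum_add_distrib, ← Finset.sum_add_distrib]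
  refine Finset.sum_congr rfl fun d₂ _ => ?_
  simp only [Set.mem_Iic, Set.mem_Ioc, Set.mem_Ioi]
  by_cases h₁ : ((d₁ * d₂ : ℕ) : ℝ) ≤ X₁
  · have h₂ : ¬ (X₁ < ((d₁ * d₂ : ℕ) : ℝ) ∧ ((d₁ * d₂ : ℕ) : ℝ) ≤ X₂) :=
      fun h => absurd h.1 (not_lt.mpr h₁)
    have h₃ : ¬ X₂ < ((d₁ * d₂ : ℕ) : ℝ) := not_lt.mpr (h₁.trans hX)
    rw [if_pos h₁, if_neg h₂, if_neg h₃]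
    ring
  · have h₁' : X₁ < ((d₁ * d₂ : ℕ) : ℝ) := not_le.mp h₁
    by_cases h₂ : ((d₁ * d₂ : ℕ) : ℝ) ≤ X₂
    · have h₃ : ¬ X₂ < ((d₁ * d₂ : ℕ) : ℝ) := not_lt.mpr h₂
      rw [if_neg h₁, if_pos ⟨h₁', h₂⟩, if_neg h₃]
      ring
    · have h₂' : X₂ < ((d₁ * d₂ : ℕ) : ℝ) := not_le.mp h₂
      have h₃ : ¬ (X₁ < ((d₁ * d₂ : ℕ) : ℝ) ∧ ((d₁ * d₂ : ℕ) : ℝ) ≤ X₂) :=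
        fun h => absurd h.2 h₂
      rw [if_neg h₁, if_neg h₃, if_pos h₂']
      ring

/-- The `ℓ¹`-over-moduli frame of the crux (divisor weight `w ≥ 0`, tame indicator `T`, one residue class
`I q` per modulus) is subadditive under a FOUR-way split of the summand: triangle inequality inside the
indicator. [bookkeeping] -/
theorem weighted_sum_le_of_split4 {s : Finset ℕ} {I : ℕ → Finset ℤ} {w : ℕ → ℝ}
    (hw : ∀ q, 0 ≤ w q) {T : ℕ → Prop} {_hT : DecidablePred T} {F FA FB FC FD : ℕ → ℤ → ℝ}
    (hF : ∀ q ∈ s, ∀ n ∈ I q, F q n = FA q n + FB q n + FC q n + FD q n) :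
    ∑ q ∈ s, w q * (if T q then |∑ n ∈ I q, F q n| else 0) ≤
      ∑ q ∈ s, w q * (if T q then |∑ n ∈ I q, FA q n| else 0) +
        ∑ q ∈ s, w q * (if T q then |∑ n ∈ I q, FB q n| else 0) +
          ∑ q ∈ s, w q * (if T q then |∑ n ∈ I q, FC q n| else 0) +
            ∑ q ∈ s, w q * (if T q then |∑ n ∈ I q, FD q n| else 0) := by
  rw [← Finset.sum_add_distrib, ← Finset.sum_add_distrib, ← Finset.sum_add_distrib]
  refine Finset.sum_le_sum fun q hq => ?_
  rw [← mul_add, ← mul_add, ← mul_add]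
  refine mul_le_mul_of_nonneg_left ?_ (hw q)
  split_ifs with hTq
  · calc |∑ n ∈ I q, F q n|
          = |∑ n ∈ I q, FA q n + ∑ n ∈ I q, FB q n + ∑ n ∈ I q, FC q n + ∑ n ∈ I q, FD q n| := by
            rw [← Finset.sum_add_distrib, ← Finset.sum_add_distrib, ← Finset.sum_add_distrib]
            exact congrArg _ (Finset.sum_congr rfl (hF q hq))
      _ ≤ |∑ n ∈ I q, FA q n + ∑ n ∈ I q, FB q n + ∑ n ∈ I q, FC q n| + |∑ n ∈ I q, FD q n| :=
            abs_add_le _ _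
      _ ≤ |∑ n ∈ I q, FA q n| + |∑ n ∈ I q, FB q n| + |∑ n ∈ I q, FC q n| + |∑ n ∈ I q, FD q n| :=
            add_le_add (abs_add_three _ _ _) le_rfl
  · simp

/-- `log N ≥ 4` once `N ≥ 64` (`log 64 = 6 log 2 > 4.15`). [bookkeeping] -/
theorem four_le_log {N : ℕ} (hN : 64 ≤ N) : (4 : ℝ) ≤ Real.log N := by
  have h64 : (64 : ℝ) ≤ (N : ℝ) := by exact_mod_cast hN
  have hlog : Real.log 64 ≤ Real.log (N : ℝ) := Real.log_le_log (by norm_num) h64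
  have h2 : Real.log (64 : ℝ) = 6 * Real.log 2 := by
    rw [show (64 : ℝ) = 2 ^ 6 by norm_num, Real.log_pow]
    norm_num
  have := Real.log_two_gt_d9
  linarith

/-- Four savings of `(log N)^{-(A+1)}` make one saving of `(log N)^{-A}` once `log N ≥ 4`. [bookkeeping] -/
theorem four_terms_bound {N : ℕ} (hN : 64 ≤ N) (A : ℝ) :
    (N : ℝ) / Real.log N ^ (A + 1) + (N : ℝ) / Real.log N ^ (A + 1) +
        (N : ℝ) / Real.log N ^ (A + 1) + (N : ℝ) / Real.log N ^ (A + 1) ≤ (N : ℝ) / Real.log N ^ A := by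
  have h4 := four_le_log hN
  have hpos : 0 < Real.log N := by linarith
  rw [Real.rpow_add hpos, Real.rpow_one, div_mul_eq_div_div]
  have hX : 0 ≤ (N : ℝ) / Real.log N ^ A :=
    div_nonneg (Nat.cast_nonneg _) (Real.rpow_nonneg hpos.le _)
  have hq : 4 / Real.log N ≤ 1 := (div_le_one hpos).mpr h4
  calc (N : ℝ) / Real.log N ^ A / Real.log N + (N : ℝ) / Real.log N ^ A / Real.log N +
        (N : ℝ) / Real.log N ^ A / Real.log N + (N : ℝ) / Real.log N ^ A / Real.log N
        = (N : ℝ) / Real.log N ^ A * (4 / Real.log N) := by ring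
    _ ≤ (N : ℝ) / Real.log N ^ A * 1 := mul_le_mul_of_nonneg_left hq hX
    _ = (N : ℝ) / Real.log N ^ A := mul_one _

/-! ### The four registered stubs (the ONLY `sorry`s of this file)

Each stub is the crux's own level-`ν`, tame-class (threshold `N^{θ/2}`, the crux's), divisor-weighted `ℓ¹`
frame — copied symbol for symbol — around one piece of the lifted expansion. `θ' = 1/2 − ν − κ` throughout. -/

/-- **Stub 1 — THE BAND TERMS (θ-lift; PROVABLE, L–XL): un-opening every small Möbius divisor.** For
`θ ≤ θ' = 1/2 − ν − κ`, the three band terms `B(ψ₁)B(ψ₂) + B(ψ₁)Λ♯_{θ'}(ψ₂) + Λ♯_{θ'}(ψ₁)B(ψ₂)`,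
`B = Λ♯_θ − Λ♯_{θ'} = ∑_{d ∣ m, N^θ < d ≤ N^{θ'}} μ(d) log(m/d)` (`bandTerm_eq_sum`), have level `ν` on tame classes
with arbitrary log-power saving. Why true: expand the band of `ψ₁` as `∑_{N^θ < d₁ ≤ N^{θ'}} μ(d₁) ∑_{n ≡ r_q (q), d₁ ∣ ψ₁(n)} log(ψ₁(n)/d₁)·(…)`;
the class `{n ≡ r_q (q), d₁ ∣ ψ₁(n)}` has modulus `≤ q d₁ ≤ N^{1/2−κ}`. Against `B(ψ₂)` (another short divisor `d₂ ≤ N^{θ'}`):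
lattice count modulo `lcm ≤ N^{ν}·N^{2θ'} = N^{1−ν−2κ}`, error `O(log² N)` per triple `(q,d₁,d₂)`, `N^{1−ν−2κ+o(1)}` in
total; main terms = truncated singular series (Möbius tails starting above `N^{θ}/g ≥ N^{θ/2}`, `≪ (log N)^{−B}`).
Against `Λ♯_{θ'}(ψ₂) = Λ(ψ₂) − Λ♭_{θ'}(ψ₂)`: ONE prime in progressions of modulus `≤ L·q d₁ ≤ L N^{1/2−κ}` —
Bombieri–Vinogradov with divisor weights (PROVED: `Literature.NumberTheory.Sieve.BombieriVinogradovStatement_holds`) —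
minus lattice counts for `Λ♭_{θ'}` (divisors `≤ N^{θ'}`, modulus `≤ N^{1−ν−2κ}`), whose main terms match the prime
main term class by class on TAME sub-classes (forced part `g ≤ N^{θ/2}·(d₁, Δ)`; the sub-classes with `(d₁,Δ) > N^{θ/2}`,
`Δ = a₁b₂ − a₂b₁ ≠ 0`, have n-mass `≪ N^{1−θ/2+o(1)}` and are discarded by Brun–Titchmarsh/Shiu-type trivial bounds) —
the one-point class-mean computation of the refuters' tame repair (REVIEW.md on stmt-Parity-15171) and of
`OpeningReduction` (iii). Consequence: the crux at truncation `θ` REDUCES to the crux at truncation `θ'`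
(both Möbius variables `> N^{1/2−ν−κ}`). Why it might fail: only through the FORM (an unfiled main term on some
tame sub-class — then the tameness bookkeeping, not the line, moves; cf. rev 2–3 of the route).
[cite: BombieriFriedlanderIwaniecActa1986, Theorem 0; GoldstonYildirim2001 / arXiv:math/0111212, Lemma 2.1;
IwaniecKowalski2004, Thm 17.1; BombieriAsymptoticSieve1976] -/
theorem stub_bandTerms :
    ∀ (L : ℕ) (θ ν A C κ : ℝ), 0 < θ → 0 ≤ ν → 0 < κ → θ ≤ 1 / 2 - ν - κ → 0 < A → 0 ≤ C →
      ∃ N₀ : ℕ, ∀ N : ℕ, N₀ ≤ N → ∀ Ψ : Fin 2 → Literature.NumberTheory.Sieve.AffLinForm 1,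
        Literature.NumberTheory.Sieve.IsNondegenerateSystem Ψ →
        Literature.NumberTheory.Sieve.affLinSize Ψ N ≤ L →
        ∀ (r u v : ℕ → ℤ), (∀ q : ℕ, -(N : ℤ) ≤ u q ∧ v q ≤ N) →
          ∑ q ∈ Finset.Icc 1 ⌊(N : ℝ) ^ ν⌋₊, ((Nat.divisors q).card : ℝ) ^ C *
            (if ∀ i : Fin 2, ((Int.gcd ((Ψ i).eval (fun _ => r q)) q : ℕ) : ℝ) ≤ (N : ℝ) ^ (θ / 2) then
              |∑ n ∈ (Finset.Icc (u q) (v q)).filter (fun n : ℤ => (q : ℤ) ∣ n - r q),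
                bandTerms N θ (1 / 2 - ν - κ)
                  ((Ψ 0).eval (fun _ => n)).toNat ((Ψ 1).eval (fun _ => n)).toNat|
            else 0) ≤ (N : ℝ) / Real.log N ^ A := by
  sorry

/-- **Stub 2 — LIFTED SMOOTH SIDE `d₁d₂ ≤ N^{1−η}` at truncation `θ' = 1/2 − ν − κ` (PROVABLE, L–XL; implied by
`birth`'s `stub_smoothSide` at `θ := θ'`, whose tameness threshold `N^{θ'/2} ≥ N^{θ/2}` is weaker).** For every
`η > ν`: doubly Type I — along a d-line (fixed `d₁, d₂`, `n` in `≤ L²` classes modulo `≍ q d₁d₂ ≤ N^{1−η+ν}`) the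
summand is the smooth `log(ψ₁/d₁) log(ψ₂/d₂)`: lattice count + partial summation, error `O(log² N)` per class,
`≪ N^{1−η+ν+o(1)}` in total; main terms are Möbius TAILS over `dᵢ > N^{θ'}/gᵢ` twisted by tame local densities,
`≪_B (log N)^{−B}` (PNT rate). Non-empty only when `η < 2ν + 2κ` (since `dᵢ > N^{θ'}` forces `D > N^{1−2ν−2κ}`).
Why it might fail: FORM only (as Stub 1). [cite: GoldstonYildirim2001, Lemma 2.1; IwaniecKowalski2004, §5.6] -/
theorem stub_liftedSmooth :
    ∀ (L : ℕ) (θ ν A C κ η : ℝ), 0 < θ → 0 ≤ ν → 0 < κ → θ ≤ 1 / 2 - ν - κ → 0 < A → 0 ≤ C → ν < η →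
      ∃ N₀ : ℕ, ∀ N : ℕ, N₀ ≤ N → ∀ Ψ : Fin 2 → Literature.NumberTheory.Sieve.AffLinForm 1,
        Literature.NumberTheory.Sieve.IsNondegenerateSystem Ψ →
        Literature.NumberTheory.Sieve.affLinSize Ψ N ≤ L →
        ∀ (r u v : ℕ → ℤ), (∀ q : ℕ, -(N : ℤ) ≤ u q ∧ v q ≤ N) →
          ∑ q ∈ Finset.Icc 1 ⌊(N : ℝ) ^ ν⌋₊, ((Nat.divisors q).card : ℝ) ^ C *
            (if ∀ i : Fin 2, ((Int.gcd ((Ψ i).eval (fun _ => r q)) q : ℕ) : ℝ) ≤ (N : ℝ) ^ (θ / 2) then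
              |∑ n ∈ (Finset.Icc (u q) (v q)).filter (fun n : ℤ => (q : ℤ) ∣ n - r q),
                coreOn N (1 / 2 - ν - κ) (Set.Iic ((N : ℝ) ^ (1 - η)))
                  ((Ψ 0).eval (fun _ => n)).toNat ((Ψ 1).eval (fun _ => n)).toNat|
            else 0) ≤ (N : ℝ) / Real.log N ^ A := by
  sorry

/-- **Stub 3 — LIFTED CENTRE `N^{1−η} < d₁d₂ ≤ N^{1+η}` with both `dᵢ > N^{1/2−ν−κ}` (THEOREM-GRADE AT `ν = 0`,
XL in Lean; open at the levels `ν ≥ ν₀` used for `t ≥ 3`).** For some `κ₀ > 0` and then every `0 < κ ≤ κ₀`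
(with `θ ≤ 1/2 − ν − κ`), some `η > ν`: the lifted centre has level `ν` on tame classes with arbitrary log-power
saving. Why true at `ν = 0` (`q = 1`): the region is the box `dᵢ ∈ (N^{1/2−κ}, 2L·N^{1/2+κ+η}]`, `D ≤ N^{1+η}` —
for `κ₀ < 1/22`, `η < 1/95` inside Duke–Friedlander–Iwaniec, 'Representations by the determinant' Thm 1
(tree: `Literature.NumberTheory.LFunctions.DukeFriedlanderIwaniec1997_determinant`, discharged `_holds`): the
determinant equation `e₁·(a₂d₁) − e₂·(a₁d₂) = a₂b₁ − a₁b₂ ≠ 0`, lower row `(n₁, n₂) = (a₁d₂, a₂d₁)` with the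
GENERAL weights `μ(d₂)`, `μ(d₁)` (sharp cut-offs allowed), upper row `(m₁, m₂) = (e₁, e₂)` with the SMOOTH
weights `log eᵢ ×` dyadic bumps (the interval cut-off `u ≤ n ≤ v`, a condition on `d₁e₁`, separated by a Mellin
transform at height `(log N)^{O(A)}`, absorbed by `η^{19/8}`); error
`‖a‖‖b‖(N₁N₂)^{3/8}(N₁+N₂)^{11/48}(…)^{19/8+ε} = N^{95/96+O(κ+η)} = o(N(log N)^{−A})`; the zero-frequency main term
`∑ ((n₁,n₂)/(n₁n₂)) μ μ ∫fg` is a truncated double Möbius series with a bounded-complexity arithmetic twist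
(`gcd ∣ Δ·a₁a₂`), `≪ N(log N)^{−B}` by the PNT for `μ` in progressions. Why open at `ν > 0`: the class condition
`d₁e₁ ≡ a₁r_q + b₁ (mod a₁q)`, worst `r_q`, `ℓ¹` over `q ≤ N^ν` — Poisson in `e₁` along a progression mod `q`
scales the dual modulus by `q`; polynomial loss in `q` gives some `ν₀ ≍ 1/96` only; `ν = (t−2)/(2t) ≥ 1/6` (the
consumer's levels for `t ≥ 3`) needs a dispersion input not in print (same status as `birth`'s centre).
Why it might fail as a statement: at `ν = 0` it would contradict DFI + PNT (so: no); at `ν > 0` only through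
the FORM (residual tame-class bias), as the crux. [cite: DukeFriedlanderIwaniec1997Determinant, Thm 1
(GreavesHarmanHuxley1997 p. 110); DukeFriedlanderIwaniec1997, Thm 2; BettinChandee2018] -/
theorem stub_liftedCentre :
    ∀ (L : ℕ) (θ ν A C : ℝ), 0 < θ → 0 ≤ ν → ν + θ < 1 / 2 → 0 < A → 0 ≤ C →
      ∃ κ₀ : ℝ, 0 < κ₀ ∧ ∀ κ : ℝ, 0 < κ → κ ≤ κ₀ → θ ≤ 1 / 2 - ν - κ →
      ∃ η : ℝ, ν < η ∧ ∃ N₀ : ℕ, ∀ N : ℕ, N₀ ≤ N → ∀ Ψ : Fin 2 → Literature.NumberTheory.Sieve.AffLinForm 1,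
        Literature.NumberTheory.Sieve.IsNondegenerateSystem Ψ →
        Literature.NumberTheory.Sieve.affLinSize Ψ N ≤ L →
        ∀ (r u v : ℕ → ℤ), (∀ q : ℕ, -(N : ℤ) ≤ u q ∧ v q ≤ N) →
          ∑ q ∈ Finset.Icc 1 ⌊(N : ℝ) ^ ν⌋₊, ((Nat.divisors q).card : ℝ) ^ C *
            (if ∀ i : Fin 2, ((Int.gcd ((Ψ i).eval (fun _ => r q)) q : ℕ) : ℝ) ≤ (N : ℝ) ^ (θ / 2) then
              |∑ n ∈ (Finset.Icc (u q) (v q)).filter (fun n : ℤ => (q : ℤ) ∣ n - r q),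
                coreOn N (1 / 2 - ν - κ) (Set.Ioc ((N : ℝ) ^ (1 - η)) ((N : ℝ) ^ (1 + η)))
                  ((Ψ 0).eval (fun _ => n)).toNat ((Ψ 1).eval (fun _ => n)).toNat|
            else 0) ≤ (N : ℝ) / Real.log N ^ A := by
  sorry

/-- **Stub 4 — LIFTED MÖBIUS SIDE `d₁d₂ > N^{1+η}`, both `dᵢ > N^{1/2−ν−κ}` (OPEN — the heart; implied by `birth`'s
`stub_moebiusSide` at `θ := 1/2 − ν − κ`).** For every `κ > 0` (with `θ ≤ 1/2 − ν − κ`) and every `η > ν`: the part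
of the lifted core carried by e-lines `n ↦ (ψ₁(n)/e₁, ψ₂(n)/e₂)`, `e₁e₂ ≤ 4L²N^{1−η}`, `eᵢ ≤ 2L N^{1/2+ν+κ}`, of length
`≥ N^{η−ν}/4L²`, along which BOTH Möbius arguments move (`d₁ = d₁⁰ + k·a₁e₂/g`, `d₂ = d₂⁰ + k·a₂e₁/g`): signed
two-point Möbius cancellation along pairs of dilated progressions, summed over the line family with weights
`log e₁ log e₂`, `(log N)^{−A}` saving at level `ν` on tame classes (the terms `dᵢ = ψᵢ(n)` vanish, `log 1 = 0`; a fixed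
small pair `(e₁, e₂)` alone is `log e₁ log e₂ · Σ_k μ(d₁⁰ + k a₁e₂/g) μ(d₂⁰ + k a₂e₁/g)`, e.g. `log²2 · Σ_{m ≤ N/2} μ(m)μ(m+1)` for
`Ψ = (n, n+2)`, `(e₁,e₂) = (2,2)` — Cesàro pair-Chowla with small dilations); HL-pair complete at `ν = 0` through the route's
CoresToTwin/TwinReduction equivalence. Why plausible: it is the crux
minus pieces provable in kind (Stubs 1–2, Stub 3 at `ν = 0`); true over `𝔽_q[T]` with a power saving uniformly in
the dilations (SawinShusterman2018 Thm 1.1/4.5). Why it might fail: everything that threatens the crux — Siegel zeros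
vs shift-uniform log-power savings (MatomakiMerikoski2023 Thm 1.3; census §Negation: `MM → USZ → HigherCores →
OpeningReduction → ¬PairCores`); natural density with a RATE where only log-averaged `(log N)^{−c}` is known
(Pilatte 2023, arXiv:2310.19357; TaoFMP2016; HelfgottRadziwill2021; `Literature.Barriers.Parity.LogarithmicAveraging`);
no signed cross-line engine (BDH for Möbius pairs on the determinant variety). Size: open problem.
[cite: SawinShusterman2018, Thm 1.1, Thm 4.5; arXiv:2310.19357; MatomakiMerikoski2023, Thm 1.3; Polymath8b2014, §8] -/
theorem stub_liftedMoebius :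
    ∀ (L : ℕ) (θ ν A C κ η : ℝ), 0 < θ → 0 ≤ ν → 0 < κ → θ ≤ 1 / 2 - ν - κ → 0 < A → 0 ≤ C → ν < η →
      ∃ N₀ : ℕ, ∀ N : ℕ, N₀ ≤ N → ∀ Ψ : Fin 2 → Literature.NumberTheory.Sieve.AffLinForm 1,
        Literature.NumberTheory.Sieve.IsNondegenerateSystem Ψ →
        Literature.NumberTheory.Sieve.affLinSize Ψ N ≤ L →
        ∀ (r u v : ℕ → ℤ), (∀ q : ℕ, -(N : ℤ) ≤ u q ∧ v q ≤ N) →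
          ∑ q ∈ Finset.Icc 1 ⌊(N : ℝ) ^ ν⌋₊, ((Nat.divisors q).card : ℝ) ^ C *
            (if ∀ i : Fin 2, ((Int.gcd ((Ψ i).eval (fun _ => r q)) q : ℕ) : ℝ) ≤ (N : ℝ) ^ (θ / 2) then
              |∑ n ∈ (Finset.Icc (u q) (v q)).filter (fun n : ℤ => (q : ℤ) ∣ n - r q),
                coreOn N (1 / 2 - ν - κ) (Set.Ioi ((N : ℝ) ^ (1 + η)))
                  ((Ψ 0).eval (fun _ => n)).toNat ((Ψ 1).eval (fun _ => n)).toNat|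
            else 0) ≤ (N : ℝ) / Real.log N ^ A := by
  sorry

/-! ### Stub signatures as propositions (verbatim the statements above; `Sig.stub_<name>` so that the
composition's hypotheses are the registered stubs BY NAME for the skeleton audit) -/

/-- Signature of `stub_bandTerms`. -/
def Sig.stub_bandTerms : Prop :=
    ∀ (L : ℕ) (θ ν A C κ : ℝ), 0 < θ → 0 ≤ ν → 0 < κ → θ ≤ 1 / 2 - ν - κ → 0 < A → 0 ≤ C →
      ∃ N₀ : ℕ, ∀ N : ℕ, N₀ ≤ N → ∀ Ψ : Fin 2 → Literature.NumberTheory.Sieve.AffLinForm 1,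
        Literature.NumberTheory.Sieve.IsNondegenerateSystem Ψ →
        Literature.NumberTheory.Sieve.affLinSize Ψ N ≤ L →
        ∀ (r u v : ℕ → ℤ), (∀ q : ℕ, -(N : ℤ) ≤ u q ∧ v q ≤ N) →
          ∑ q ∈ Finset.Icc 1 ⌊(N : ℝ) ^ ν⌋₊, ((Nat.divisors q).card : ℝ) ^ C *
            (if ∀ i : Fin 2, ((Int.gcd ((Ψ i).eval (fun _ => r q)) q : ℕ) : ℝ) ≤ (N : ℝ) ^ (θ / 2) then
              |∑ n ∈ (Finset.Icc (u q) (v q)).filter (fun n : ℤ => (q : ℤ) ∣ n - r q),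
                bandTerms N θ (1 / 2 - ν - κ)
                  ((Ψ 0).eval (fun _ => n)).toNat ((Ψ 1).eval (fun _ => n)).toNat|
            else 0) ≤ (N : ℝ) / Real.log N ^ A

/-- Signature of `stub_liftedSmooth`. -/
def Sig.stub_liftedSmooth : Prop :=
    ∀ (L : ℕ) (θ ν A C κ η : ℝ), 0 < θ → 0 ≤ ν → 0 < κ → θ ≤ 1 / 2 - ν - κ → 0 < A → 0 ≤ C → ν < η →
      ∃ N₀ : ℕ, ∀ N : ℕ, N₀ ≤ N → ∀ Ψ : Fin 2 → Literature.NumberTheory.Sieve.AffLinForm 1,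
        Literature.NumberTheory.Sieve.IsNondegenerateSystem Ψ →
        Literature.NumberTheory.Sieve.affLinSize Ψ N ≤ L →
        ∀ (r u v : ℕ → ℤ), (∀ q : ℕ, -(N : ℤ) ≤ u q ∧ v q ≤ N) →
          ∑ q ∈ Finset.Icc 1 ⌊(N : ℝ) ^ ν⌋₊, ((Nat.divisors q).card : ℝ) ^ C *
            (if ∀ i : Fin 2, ((Int.gcd ((Ψ i).eval (fun _ => r q)) q : ℕ) : ℝ) ≤ (N : ℝ) ^ (θ / 2) then
              |∑ n ∈ (Finset.Icc (u q) (v q)).filter (fun n : ℤ => (q : ℤ) ∣ n - r q),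
                coreOn N (1 / 2 - ν - κ) (Set.Iic ((N : ℝ) ^ (1 - η)))
                  ((Ψ 0).eval (fun _ => n)).toNat ((Ψ 1).eval (fun _ => n)).toNat|
            else 0) ≤ (N : ℝ) / Real.log N ^ A

/-- Signature of `stub_liftedCentre`. -/
def Sig.stub_liftedCentre : Prop :=
    ∀ (L : ℕ) (θ ν A C : ℝ), 0 < θ → 0 ≤ ν → ν + θ < 1 / 2 → 0 < A → 0 ≤ C →
      ∃ κ₀ : ℝ, 0 < κ₀ ∧ ∀ κ : ℝ, 0 < κ → κ ≤ κ₀ → θ ≤ 1 / 2 - ν - κ →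
      ∃ η : ℝ, ν < η ∧ ∃ N₀ : ℕ, ∀ N : ℕ, N₀ ≤ N → ∀ Ψ : Fin 2 → Literature.NumberTheory.Sieve.AffLinForm 1,
        Literature.NumberTheory.Sieve.IsNondegenerateSystem Ψ →
        Literature.NumberTheory.Sieve.affLinSize Ψ N ≤ L →
        ∀ (r u v : ℕ → ℤ), (∀ q : ℕ, -(N : ℤ) ≤ u q ∧ v q ≤ N) →
          ∑ q ∈ Finset.Icc 1 ⌊(N : ℝ) ^ ν⌋₊, ((Nat.divisors q).card : ℝ) ^ C *
            (if ∀ i : Fin 2, ((Int.gcd ((Ψ i).eval (fun _ => r q)) q : ℕ) : ℝ) ≤ (N : ℝ) ^ (θ / 2) then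
              |∑ n ∈ (Finset.Icc (u q) (v q)).filter (fun n : ℤ => (q : ℤ) ∣ n - r q),
                coreOn N (1 / 2 - ν - κ) (Set.Ioc ((N : ℝ) ^ (1 - η)) ((N : ℝ) ^ (1 + η)))
                  ((Ψ 0).eval (fun _ => n)).toNat ((Ψ 1).eval (fun _ => n)).toNat|
            else 0) ≤ (N : ℝ) / Real.log N ^ A

/-- Signature of `stub_liftedMoebius`. -/
def Sig.stub_liftedMoebius : Prop :=
    ∀ (L : ℕ) (θ ν A C κ η : ℝ), 0 < θ → 0 ≤ ν → 0 < κ → θ ≤ 1 / 2 - ν - κ → 0 < A → 0 ≤ C → ν < η →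
      ∃ N₀ : ℕ, ∀ N : ℕ, N₀ ≤ N → ∀ Ψ : Fin 2 → Literature.NumberTheory.Sieve.AffLinForm 1,
        Literature.NumberTheory.Sieve.IsNondegenerateSystem Ψ →
        Literature.NumberTheory.Sieve.affLinSize Ψ N ≤ L →
        ∀ (r u v : ℕ → ℤ), (∀ q : ℕ, -(N : ℤ) ≤ u q ∧ v q ≤ N) →
          ∑ q ∈ Finset.Icc 1 ⌊(N : ℝ) ^ ν⌋₊, ((Nat.divisors q).card : ℝ) ^ C *
            (if ∀ i : Fin 2, ((Int.gcd ((Ψ i).eval (fun _ => r q)) q : ℕ) : ℝ) ≤ (N : ℝ) ^ (θ / 2) then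
              |∑ n ∈ (Finset.Icc (u q) (v q)).filter (fun n : ℤ => (q : ℤ) ∣ n - r q),
                coreOn N (1 / 2 - ν - κ) (Set.Ioi ((N : ℝ) ^ (1 + η)))
                  ((Ψ 0).eval (fun _ => n)).toNat ((Ψ 1).eval (fun _ => n)).toNat|
            else 0) ≤ (N : ℝ) / Real.log N ^ A

/-! ### Composition: the four stubs prove the crux BY NAME (real proof, no `sorry`) -/

/-- **Composition.** `stub_bandTerms → stub_liftedSmooth → stub_liftedCentre → stub_liftedMoebius → PairCores`,
the conclusion being literally the route decl
`Summit.Parity.GeneralizedHardyLittlewood.Theses.DeterminantMoebiusCores.PairCores`. Proof: `κ₀` from the centre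
stub (saving `A+1`), `κ := min κ₀ (1/2 − ν − θ)`, `η` and the four bounds at `(A+1, κ, η)`, the lift identity
`lamSharp_mul_lift` at `θ' = 1/2 − ν − κ`, the hyperbolic trichotomy `lamSharp_mul_split` of the lifted core at
`N^{1−η} ≤ N^{1+η}`, subadditivity of the tame `ℓ¹` frame (`weighted_sum_le_of_split4`) and
`4N/(log N)^{A+1} ≤ N/(log N)^A` for `N ≥ 64`. -/
theorem PairCores_of :
    Sig.stub_bandTerms → Sig.stub_liftedSmooth → Sig.stub_liftedCentre → Sig.stub_liftedMoebius →
      Summit.Parity.GeneralizedHardyLittlewood.Theses.DeterminantMoebiusCores.PairCores := by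
  intro hBand hS hCen hM L θ ν A C hθ hν hνθ hA0 hC0
  have hA1 : 0 < A + 1 := by linarith
  obtain ⟨κ₀, hκ₀, hcen⟩ := hCen L θ ν (A + 1) C hθ hν hνθ hA1 hC0
  have hgap : 0 < 1 / 2 - ν - θ := by linarith
  set κ : ℝ := min κ₀ (1 / 2 - ν - θ) with hκdef
  have hκpos : 0 < κ := lt_min hκ₀ hgap
  have hκle : κ ≤ κ₀ := min_le_left _ _
  have hκle' : κ ≤ 1 / 2 - ν - θ := min_le_right _ _
  have hθle : θ ≤ 1 / 2 - ν - κ := by linarith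
  obtain ⟨η, hη, NB, hNB⟩ := hcen κ hκpos hκle hθle
  obtain ⟨NA, hNA⟩ := hBand L θ ν (A + 1) C κ hθ hν hκpos hθle hA1 hC0
  obtain ⟨NS, hNS⟩ := hS L θ ν (A + 1) C κ η hθ hν hκpos hθle hA1 hC0 hη
  obtain ⟨NM, hNM⟩ := hM L θ ν (A + 1) C κ η hθ hν hκpos hθle hA1 hC0 hη
  refine ⟨max (max (max NA NB) (max NS NM)) 64, fun N hN Ψ hΨ hL r u v huv => ?_⟩
  have h64 : 64 ≤ N := le_trans (le_max_right _ _) hN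
  have hN' : max (max NA NB) (max NS NM) ≤ N := le_trans (le_max_left _ _) hN
  have hNA' : NA ≤ N := le_trans (le_trans (le_max_left _ _) (le_max_left _ _)) hN'
  have hNB' : NB ≤ N := le_trans (le_trans (le_max_right _ _) (le_max_left _ _)) hN'
  have hNS' : NS ≤ N := le_trans (le_trans (le_max_left _ _) (le_max_right _ _)) hN'
  have hNM' : NM ≤ N := le_trans (le_trans (le_max_right _ _) (le_max_right _ _)) hN'
  have bA := hNA N hNA' Ψ hΨ hL r u v huv
  have bB := hNB N hNB' Ψ hΨ hL r u v huv
  have bS := hNS N hNS' Ψ hΨ hL r u v huv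
  have bM := hNM N hNM' Ψ hΨ hL r u v huv
  have h1N : (1 : ℝ) ≤ (N : ℝ) := by exact_mod_cast (le_trans (by norm_num) h64 : 1 ≤ N)
  have hX : (N : ℝ) ^ (1 - η) ≤ (N : ℝ) ^ (1 + η) :=
    Real.rpow_le_rpow_of_exponent_le h1N (by linarith)
  refine le_trans (weighted_sum_le_of_split4 (fun q => Real.rpow_nonneg (Nat.cast_nonneg _) C)
    (FA := fun q n => bandTerms N θ (1 / 2 - ν - κ)
      ((Ψ 0).eval (fun _ => n)).toNat ((Ψ 1).eval (fun _ => n)).toNat)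
    (FB := fun q n => coreOn N (1 / 2 - ν - κ) (Set.Iic ((N : ℝ) ^ (1 - η)))
      ((Ψ 0).eval (fun _ => n)).toNat ((Ψ 1).eval (fun _ => n)).toNat)
    (FC := fun q n => coreOn N (1 / 2 - ν - κ) (Set.Ioc ((N : ℝ) ^ (1 - η)) ((N : ℝ) ^ (1 + η)))
      ((Ψ 0).eval (fun _ => n)).toNat ((Ψ 1).eval (fun _ => n)).toNat)
    (FD := fun q n => coreOn N (1 / 2 - ν - κ) (Set.Ioi ((N : ℝ) ^ (1 + η)))
      ((Ψ 0).eval (fun _ => n)).toNat ((Ψ 1).eval (fun _ => n)).toNat) ?_) ?_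
  · intro q hq n hn
    refine (Fin.prod_univ_two _).trans ?_
    show lamSharp N θ _ * lamSharp N θ _ = _
    rw [lamSharp_mul_lift N θ (1 / 2 - ν - κ), lamSharp_mul_split N (1 / 2 - ν - κ) hX]
    ring
  · exact le_trans (add_le_add (add_le_add (add_le_add bA bS) bB) bM) (four_terms_bound h64 A)

/-- The skeleton in its final shape: the crux BY NAME from the four registered stubs (it becomes a proof of the
crux when the last `stub_*` is discharged; until then it depends on `sorryAx` through the stubs only — no `sorry`
of its own). [bookkeeping] -/
theorem PairCores_proof :
    Summit.Parity.GeneralizedHardyLittlewood.Theses.DeterminantMoebiusCores.PairCores :=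
  PairCores_of stub_bandTerms stub_liftedSmooth stub_liftedCentre stub_liftedMoebius

end Summit.Parity.GeneralizedHardyLittlewood.Cruxes.PairCores.ThetaLift
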